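import Mathlib
import Literature.Computability.MetaComplexity.MCSPNoMergeablePair
import Literature.Computability.MetaComplexity.ProbabilisticCircuitSensitivityBounds
import Literature.Computability.MetaComplexity.ChenLiYang2022.ProbabilisticCircuits
import HarnessLib

/-!
# The first gate-elimination step against PROBABILISTIC circuits — `MCSP[θ]` at error `N^{-c}`, `c > 2`

Literature / circuit complexity, and census row R10 (Chen–Li–Yang CCC 2022, Thm. 1.6),
probabilistic KNOWN column: the companion of `MCSPNoMergeablePair.lean` for distributions over
circuits. Everything is PROVED; the file is def-free; no named fact.

* `PMF.exists_mem_support_forall_eval_eq` — union bound: error `≤ ε` at every input and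
  `|W|·ε < 1` imply that some circuit of the support is correct on all of `W`.
* `PMF.card_le_of_noMergeablePair` — if the "no mergeable pair" witnesses of `f` (two inputs per
  triple `(i, j, φ)`) lie in a finite set `W` with `|W|·ε < 1`, then every distribution over `B₂`
  circuits of size `≤ s` computing `f` with error `≤ ε` at every input has `N ≤ s`: apply
  `Circuit.card_le_size_of_noMergeablePair` (Wegener 1987 §5.2, proof of Thm. 2.1, first gate,
  surgery-free form) to a support circuit correct on `W` and to the function THAT circuit computes
  (the witnesses separate its values).
* `MCSPSize_exists_witnessSet` — for `MCSP[θ]` (at a length with `1 ≤ θ(n)` and fewer than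
  `2^{2^{n-1}}` functions of complexity `≤ θ(n)`) the witnesses of `MCSPSize_noMergeablePair` fit
  in `≤ 32·N²` tables; `MCSPSize_not_mem_PSIZEae_of_noMergeablePair` is the family form (side
  condition `32·N²·ε(N) < 1`); numerics `eventually_witness_budget` (`32·N^{2−c} < 1`, `c > 2`).
* **`MCSPSize_not_mem_PSIZEae_sub_one`** — the cell: for every `θ` with eventually
  `1 ≤ θ(n) ≤ ⌈2^{βn}⌉`, `0 ≤ β < 1`, and every `c > 2`, `MCSPSize θ ∉ PSIZEae (N^{-c}) (N − 1)`:
  `N` gates infinitely often, matching the deterministic cell `MCSPSize_not_mem_SIZEae_sub_one`.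
  For `1 < c ≤ 2` the light-cone cell `MCSPSize_not_mem_PSIZEae_sub_three` (`N − 2` gates) and
  for `c ≤ 1` `MCSPSize_not_mem_PSIZEae_sublinear` remain the tree's best. NEEDED (CLY Thm. 1.6):
  `2N + C·N/log log N` for EVERY `c > 0` — the exponent range `c > 2` is where the union bound
  over the `O(N²)` witnesses is free; it is a feature of the argument, not a threshold of the
  problem, and no threshold is minted. Honest scope as in the deterministic file: only level one
  of Schnorr's class `Q_{2,3}` is used; the method ceiling of the static step is `N`; CLY p. 7:
  `2N − o(N)` is open even against deterministic circuits.

References: I. Wegener, *The Complexity of Boolean Functions* (1987), §5.2 Thm. 2.1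
[Wegener1987]; L. Chen, J. Li, T. Yang, CCC 2022, Thm. 1.6 and §2.2 [ChenLiYang2022];
S. Arora, B. Barak (2009), §A.2 (union bound) [AroraBarak2009].
-/

namespace Literature.Computability.Complexity

open Finset
open scoped ENNReal

variable {N : ℕ}

/-- **Union bound over a finite witness set.** If a distribution `μ` over circuits errs on `f`
with probability `≤ ε` at every input and `|W|·ε < 1`, some circuit in the support of `μ` is
correct on every input of `W`. [cite: AroraBarak2009, §A.2 (union bound); ChenLiYang2022, §2.2 (probabilistic circuits: error ≤ ε at every input)] -/
theorem PMF.exists_mem_support_forall_eval_eq (μ : PMF (Circuit (Fin N))) {ε : ℝ≥0∞}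
    {f : (Fin N → Bool) → Bool} (herr : ∀ x, μ.toOuterMeasure {C | C.eval x ≠ f x} ≤ ε)
    (W : Finset (Fin N → Bool)) (hW : (W.card : ℝ≥0∞) * ε < 1) :
    ∃ C ∈ μ.support, ∀ x ∈ W, C.eval x = f x := by
  classical
  by_contra h
  push Not at h
  have hcover : μ.support ⊆ ⋃ x ∈ W, {C : Circuit (Fin N) | C.eval x ≠ f x} := by
    intro C hC
    obtain ⟨x, hx, hne⟩ := h C hC
    exact Set.mem_biUnion (Finset.mem_coe.2 hx) hne
  have h1 : μ.toOuterMeasure (⋃ x ∈ W, {C : Circuit (Fin N) | C.eval x ≠ f x}) = 1 :=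
    (PMF.toOuterMeasure_apply_eq_one_iff _ _).2 hcover
  have hle : (1 : ℝ≥0∞) ≤ (W.card : ℝ≥0∞) * ε :=
    calc (1 : ℝ≥0∞) = μ.toOuterMeasure (⋃ x ∈ W, {C : Circuit (Fin N) | C.eval x ≠ f x}) :=
          h1.symm
      _ ≤ ∑ x ∈ W, μ.toOuterMeasure {C : Circuit (Fin N) | C.eval x ≠ f x} :=
          MeasureTheory.measure_biUnion_finset_le _ _
      _ ≤ ∑ _x ∈ W, ε := Finset.sum_le_sum fun x _ => herr x
      _ = (W.card : ℝ≥0∞) * ε := by rw [Finset.sum_const, nsmul_eq_mul]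
  exact absurd hW (not_lt.2 hle)

/-- **The first gate-elimination step, probabilistic form.** If a distribution `μ` over `B₂`
circuits with `≤ s` gates computes `f : {0,1}^N → {0,1}` with error `≤ ε` at every input, and the
"no mergeable pair" hypothesis of `Circuit.card_le_size_of_noMergeablePair` holds for `f` with
all its witnesses inside a finite set `W` with `|W|·ε < 1`, then `N ≤ s`: by the union bound some
circuit of the support is correct on all of `W`, and the deterministic theorem applies to that
circuit and the function IT computes (the witnesses separate its values).
[cite: Wegener1987, §5.2 Thm. 2.1 (proof, first gate; here for a circuit correct on the witness set only); ChenLiYang2022, §2.2 (probabilistic B₂ circuits)] -/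
theorem PMF.card_le_of_noMergeablePair (μ : PMF (Circuit (Fin N))) {s : ℕ} {ε : ℝ≥0∞}
    (hμ : ∀ C ∈ μ.support, C.IsOver B2 ∧ C.size ≤ s) {f : (Fin N → Bool) → Bool}
    (herr : ∀ x, μ.toOuterMeasure {C | C.eval x ≠ f x} ≤ ε) (hN : 2 ≤ N)
    (W : Finset (Fin N → Bool))
    (hpair : ∀ i j : Fin N, i ≠ j → ∀ φ : Bool → Bool → Bool, ∃ x ∈ W, ∃ y ∈ W,
      (∀ k, k ≠ i → k ≠ j → x k = y k) ∧ φ (x i) (x j) = φ (y i) (y j) ∧ f x ≠ f y)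
    (hW : (W.card : ℝ≥0∞) * ε < 1) : N ≤ s := by
  classical
  obtain ⟨C, hC, hCW⟩ := PMF.exists_mem_support_forall_eval_eq μ herr W hW
  obtain ⟨hB, hsz⟩ := hμ C hC
  have key := C.card_le_size_of_noMergeablePair hB (f := fun x => C.eval x) (fun _ => rfl)
    (by simpa using hN) (fun i j hij φ => by
      obtain ⟨x, hx, y, hy, hxy, hφ, hf⟩ := hpair i j hij φ
      exact ⟨x, y, hxy, hφ, by rwa [hCW x hx, hCW y hy]⟩)
  simpa using key.trans hsz

end Literature.Computability.Complexity

namespace Literature.Computability.MetaComplexity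

open Filter Finset Literature.Computability.Complexity
open scoped ENNReal

variable {n : ℕ}

/-- **A witness set of size `≤ 32·N²` for `MCSP[θ]`.** At a length where `1 ≤ θ(n)` and fewer
than `2^{2^{n-1}}` functions have complexity `≤ θ(n)`, the witnesses of `MCSPSize_noMergeablePair`
(two tables per triple `(i, j, φ)`) can be collected in a set of at most `2·16·N²` tables.
[cite: Wegener1987, §5.2 Def. 2.1 / Thm. 2.1 (proof, first gate: level-one condition for f = MCSP[θ], proved in-tree; witnesses counted)] -/
theorem MCSPSize_exists_witnessSet {θ : ℕ → ℕ} (hθ : 1 ≤ θ n)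
    (hcount : (univ.filter fun g : (Fin n → Bool) → Bool => circuitSizeOver B2 g ≤ θ n).card <
      2 ^ 2 ^ (n - 1)) :
    ∃ W : Finset (Fin (2 ^ n) → Bool), W.card ≤ 32 * (2 ^ n) ^ 2 ∧
      ∀ i j : Fin (2 ^ n), i ≠ j → ∀ φ : Bool → Bool → Bool, ∃ x ∈ W, ∃ y ∈ W,
        (∀ k, k ≠ i → k ≠ j → x k = y k) ∧ φ (x i) (x j) = φ (y i) (y j) ∧
        (MCSPSize θ).boolIndicator (List.ofFn x) ≠ (MCSPSize θ).boolIndicator (List.ofFn y) := by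
  classical
  have hch : ∀ t : Fin (2 ^ n) × Fin (2 ^ n) × (Bool → Bool → Bool), t.1 ≠ t.2.1 →
      ∃ x y : Fin (2 ^ n) → Bool, (∀ k, k ≠ t.1 → k ≠ t.2.1 → x k = y k) ∧
        t.2.2 (x t.1) (x t.2.1) = t.2.2 (y t.1) (y t.2.1) ∧
        (MCSPSize θ).boolIndicator (List.ofFn x) ≠ (MCSPSize θ).boolIndicator (List.ofFn y) :=
    fun t ht => MCSPSize_noMergeablePair hθ hcount t.1 t.2.1 ht t.2.2
  choose! X Y hXY using hch
  refine ⟨univ.image X ∪ univ.image Y, ?_, ?_⟩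
  · have hT : Fintype.card (Fin (2 ^ n) × Fin (2 ^ n) × (Bool → Bool → Bool)) =
        16 * (2 ^ n) ^ 2 := by
      simp only [Fintype.card_prod, Fintype.card_fin, Fintype.card_fun, Fintype.card_bool]
      ring
    calc (univ.image X ∪ univ.image Y).card ≤ (univ.image X).card + (univ.image Y).card :=
          card_union_le _ _
      _ ≤ univ.card + univ.card := Nat.add_le_add card_image_le card_image_le
      _ = 32 * (2 ^ n) ^ 2 := by rw [Finset.card_univ, hT]; ring
  · intro i j hij φ
    obtain ⟨hxy, hφ, hne⟩ := hXY (i, j, φ) hij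
    exact ⟨X (i, j, φ), mem_union_left _ (mem_image_of_mem _ (mem_univ _)),
      Y (i, j, φ), mem_union_right _ (mem_image_of_mem _ (mem_univ _)), hxy, hφ, hne⟩

/-- **`MCSP[θ] ∉ PSIZEae ε s` — `N` gates against probabilistic circuits of tiny error.** If
infinitely often `1 ≤ θ(n)`, fewer than `2^{2^{n-1}}` functions have complexity `≤ θ(n)`,
`s(N) + 1 ≤ N` and `32·N²·ε(N) < 1` (`N = 2ⁿ`), then no probabilistic `B₂` family of size `≤ s`
and error `≤ ε` decides `MCSP[θ]` (`PMF.card_le_of_noMergeablePair` with the witness set of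
`MCSPSize_exists_witnessSet`).
[cite: ChenLiYang2022, Thm. 1.6 (known column) and §2.2 (probabilistic B₂ circuits); Wegener1987, §5.2 Thm. 2.1 (proof, first gate)] -/
theorem MCSPSize_not_mem_PSIZEae_of_noMergeablePair {θ s : ℕ → ℕ} {ε : ℕ → ℝ≥0∞}
    (h : ∃ᶠ n : ℕ in atTop, 1 ≤ n ∧ 1 ≤ θ n ∧
      (univ.filter fun g : (Fin n → Bool) → Bool => circuitSizeOver B2 g ≤ θ n).card <
        2 ^ 2 ^ (n - 1) ∧ s (2 ^ n) + 1 ≤ 2 ^ n ∧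
      ((32 * (2 ^ n) ^ 2 : ℕ) : ℝ≥0∞) * ε (2 ^ n) < 1) :
    MCSPSize θ ∉ ChenLiYang2022.PSIZEae ε s := by
  classical
  rintro ⟨F, ⟨n₀, hn₀⟩, hF⟩
  obtain ⟨n, hn₁, hn1, hθ, hcount, hs, hε⟩ := frequently_atTop.1 h n₀
  have hn0 : n₀ ≤ 2 ^ n := hn₁.trans n.lt_two_pow_self.le
  set μ : PMF (Circuit (Fin (2 ^ n))) := F (2 ^ n) with hμdef
  have hμ : ∀ C ∈ μ.support, C.IsOver B2 ∧ C.size ≤ s (2 ^ n) := fun C hC => hn₀ _ hn0 C hC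
  have herr : ∀ x : Fin (2 ^ n) → Bool,
      μ.toOuterMeasure {C | C.eval x ≠ (MCSPSize θ).boolIndicator (List.ofFn x)} ≤ ε (2 ^ n) :=
    fun x => PFamilyAE.toOuterMeasure_ofFn_le hF x
  obtain ⟨W, hWcard, hW⟩ := MCSPSize_exists_witnessSet hθ hcount
  have hN2 : 2 ≤ 2 ^ n :=
    calc 2 = 2 ^ 1 := rfl
      _ ≤ 2 ^ n := Nat.pow_le_pow_right (by norm_num) hn1
  have hWle : (W.card : ℝ≥0∞) * ε (2 ^ n) ≤ ((32 * (2 ^ n) ^ 2 : ℕ) : ℝ≥0∞) * ε (2 ^ n) := by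
    gcongr
  have hWε : (W.card : ℝ≥0∞) * ε (2 ^ n) < 1 := lt_of_le_of_lt hWle hε
  have := PMF.card_le_of_noMergeablePair μ hμ herr hN2 W hW hWε
  omega

/-- Numerics: `32·N²·N^{-c} < 1` eventually along `N = 2ⁿ`, for every `c > 2`.
[cite: ChenLiYang2022, §1.2.1 (error 1/poly; bookkeeping for the exponent range c > 2)] -/
theorem eventually_witness_budget {c : ℝ} (hc : 2 < c) :
    ∀ᶠ n : ℕ in atTop,
      ((32 * (2 ^ n) ^ 2 : ℕ) : ℝ≥0∞) * ChenLiYang2022.invPoly c (2 ^ n) < 1 := by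
  have h1 : Tendsto (fun n : ℕ => ((2 ^ n : ℕ) : ℝ)) atTop atTop :=
    tendsto_natCast_atTop_atTop.comp (tendsto_pow_atTop_atTop_of_one_lt one_lt_two)
  have h2 := ((tendsto_rpow_atTop (by linarith : (0 : ℝ) < c - 2)).comp h1).eventually_gt_atTop 32
  filter_upwards [h2] with n hn
  have hn' : (32 : ℝ) < ((2 ^ n : ℕ) : ℝ) ^ (c - 2) := hn
  set Nr : ℝ := ((2 ^ n : ℕ) : ℝ) with hNr
  have hNpos : 0 < Nr := by rw [hNr]; positivity
  have hpow : Nr ^ c = Nr ^ (c - 2) * Nr ^ 2 := by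
    rw [← Real.rpow_natCast Nr 2, ← Real.rpow_add hNpos]
    norm_num
  have hreal : (32 * Nr ^ 2) * (Nr ^ c)⁻¹ < 1 := by
    rw [mul_inv_lt_iff₀ (Real.rpow_pos_of_pos hNpos c), one_mul, hpow]
    exact mul_lt_mul_of_pos_right hn' (by positivity)
  unfold ChenLiYang2022.invPoly
  have hcast : ((32 * (2 ^ n) ^ 2 : ℕ) : ℝ≥0∞) = ENNReal.ofReal (32 * Nr ^ 2) := by
    rw [hNr, ← ENNReal.ofReal_natCast]
    push_cast
    ring_nf
  rw [hcast, ← ENNReal.ofReal_mul (by positivity), ENNReal.ofReal_lt_one]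
  simpa [hNr] using hreal

/-- **Row R10 cell, probabilistic column at error exponent `c > 2`: `MCSP[θ] ∉ PSIZEae (N^{-c})
(N − 1)`** — `N` gates are necessary, infinitely often, for every probabilistic `B₂` family of
error `≤ N^{-c}`, `c > 2`, deciding `MCSP[θ]`, for every `θ` with eventually
`1 ≤ θ(n) ≤ ⌈2^{βn}⌉`, `0 ≤ β < 1` (the row's `θ = ⌊n^β⌋` included). The deterministic cell
`MCSPSize_not_mem_SIZEae_sub_one` is the case of Dirac families; the tree's cell at `1 < c` is
`N − 2` gates (`MCSPSize_not_mem_PSIZEae_sub_three`, light cones).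
[cite: ChenLiYang2022, Thm. 1.6 (known column; error 1/poly, here exponent c > 2) and §2.2; Wegener1987, §5.2 Thm. 2.1 (proof, first gate)] -/
theorem MCSPSize_not_mem_PSIZEae_sub_one {θ : ℕ → ℕ} {β : ℝ} (hβ : 0 ≤ β) (hβ1 : β < 1)
    (hθ1 : ∀ᶠ n : ℕ in atTop, 1 ≤ θ n)
    (hθ : ∀ᶠ n : ℕ in atTop, θ n ≤ OliveiraPichSanthanam2019.noBound β n) {c : ℝ} (hc : 2 < c) :
    MCSPSize θ ∉ ChenLiYang2022.PSIZEae (ChenLiYang2022.invPoly c) fun N => N - 1 := by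
  classical
  refine MCSPSize_not_mem_PSIZEae_of_noMergeablePair (Eventually.frequently ?_)
  filter_upwards [hθ1, hθ, eventually_count_noBound_lt_two_pow_half hβ hβ1,
    eventually_ge_atTop 1, eventually_witness_budget hc] with n h1 hθn hcount hn hbudget
  refine ⟨hn, h1, lt_of_le_of_lt (card_le_card fun g hg => ?_) hcount, ?_, hbudget⟩
  · simp only [mem_filter, mem_univ, true_and] at hg ⊢
    exact hg.trans hθn
  · have : 1 ≤ 2 ^ n := Nat.one_le_two_pow
    show 2 ^ n - 1 + 1 ≤ 2 ^ n
    omega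

end Literature.Computability.MetaComplexity
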